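import Literature.AlgebraicGeometry.Resolution.Hironaka1964LocalComplete
import Literature.AlgebraicGeometry.Resolution.AdicCompletionRegular
import Literature.AlgebraicGeometry.Resolution.GRingAdicCompletionRegularHom
import Literature.AlgebraicGeometry.Resolution.GeometricallyRegularFG
import Literature.AlgebraicGeometry.Resolution.ExcellentRingsEssFiniteType
import Literature.AlgebraicGeometry.Resolution.ExcellentRingsFieldProofs
import Literature.AlgebraicGeometry.Resolution.ResolutionLocalization
import HarnessLib

/-!
# Crux `PatchingRelPerfect` (stmt-ResolutionOfSingularities-16161), line `closed-point-slice`: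
# helpers for the stub `stub_algebraizeBlowup` (completion descent in blow-up format)

Route `ResolutionOfSingularities/FrobeniusClosing`, crux #6 `PatchingRelPerfect`. The stub
`stub_algebraizeBlowup` passes from the atom over a COMPLETE regular local base to an algebraic
regular local base `S` (essentially of finite type over a perfect field `k`, closed point) by
completing `S` at `𝔪` and pulling a proper birational `T → Spec S` back to `T̂ = T ×_S Spec Ŝ`.
This file supplies, sorry-free, the facts about `Ŝ` and `T̂` that the passage consumes (the
descent itself is in `FrobeniusClosingPatchingRelPerfectAlgebraizeBlowup.lean`):

* `charP_adicCompletion`, `perfectField_residueField_adicCompletion`,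
  `isRegularHom_adicCompletion_of_essFiniteType` (`S` is excellent: `Stacks07QW_field_holds`,
  `IsExcellentRing.of_essFiniteType`; EGA IV₂ 7.8.3 (v)), `specMap_eq_closedPoint_iff`, packaged
  as the registered sub-goal `stub_algebraizeBlowupCompletion`;
* `isBirational_pullback_snd_specMap` — for domains `S ⊆ E` with `E` flat over `S` and a
  birational `f : T → Spec S` from an irreducible `T`, the base change `T ×_S Spec E → Spec E`
  is birational (the preimage of the good open is dense because the flat projection to `T` is
  generizing); hence `T ×_S Spec E` is irreducible;
* `isReduced_pullback_specMap_of_isRegularHom`,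
  `isRegularLocalRing_stalk_pullback_of_isRegularHom` — along a regular homomorphism `S → E`
  (`T` locally of finite type over the Noetherian `S`), `T ×_S Spec E` is reduced when `T` is,
  and is regular at every point whose image in `T` is regular (Stacks 07C1
  `IsRegularHom.baseChange_of_essFiniteType` on the charts `Spec (Γ(T, W) ⊗_S E)`, Stacks 07QK
  `IsRegularHom.isReduced`, Matsumura 23.7 `isRegularLocalRing_localization_iff`);
* `comap_map_fst_eq_of_pow_le` — ideal sheaves on `T ×_S Spec E` above `(I 𝒪)ᴺ` are extended
  from `T` when `E ≡ S (mod Iᴺ)` (the descent of fibre-cosupported blow-up centres).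

Sources: M. Temkin, Adv. Math. 219 (2008), Lemma 3.1.4, Cor. 3.1.5, proof of Thm. 3.4.1
[Temkin2008]; EGA IV₂ (7.8.3) (v), (7.9.3) [EGAIV2]; H. Matsumura, *Commutative Ring Theory*
(1986), Thm. 23.7, §32 [Matsumura1987]; The Stacks Project, Tags 07C1, 07QK, 01RN [StacksProject].
-/

set_option linter.dupNamespace false -- single-problem summit: doubled namespace component is forced

noncomputable section

open CategoryTheory CategoryTheory.Limits AlgebraicGeometry Literature.AlgebraicGeometry.Resolution
open IsLocalRing TensorProduct TopologicalSpace

namespace Summit.ResolutionOfSingularities.ResolutionOfSingularities.Theorems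

universe u

/-! ## The completion of the base -/

section Completion

variable (p : ℕ) (k : Type u) [Field k] (S : Type u) [CommRing S] [IsLocalRing S]
  [IsNoetherianRing S] [Algebra k S]

/-- `Ŝ` has the characteristic of the ground field `k ⊆ S` (the composite `k → S → Ŝ` is an
injective ring homomorphism out of a field). [folklore] -/
theorem charP_adicCompletion [CharP k p] : CharP (AdicCompletion (maximalIdeal S) S) p :=
  charP_of_injective_ringHom
    (f := (algebraMap S (AdicCompletion (maximalIdeal S) S)).comp (algebraMap k S))
    (RingHom.injective _) p

/-- **The residue field of `Ŝ` is perfect** when `S/𝔪` is finite over a perfect field `k`: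
`S/𝔪` is then an algebraic extension of `k`, hence perfect, and `Ŝ/𝔪̂ ≅ S/𝔪`
(`AdicCompletion.residueField_map_bijective`). [folklore] -/
theorem perfectField_residueField_adicCompletion [PerfectField k]
    (hfin : Module.Finite k (S ⧸ maximalIdeal S)) :
    PerfectField (ResidueField (AdicCompletion (maximalIdeal S) S)) := by
  haveI : Module.Finite k (ResidueField S) := hfin
  haveI : Algebra.IsAlgebraic k (ResidueField S) := Algebra.IsAlgebraic.of_finite k _
  haveI : PerfectField (ResidueField S) := Algebra.IsAlgebraic.perfectField k
  exact PerfectField.of_ringEquiv (RingEquiv.ofBijective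
    (ResidueField.map (algebraMap S (AdicCompletion (maximalIdeal S) S)))
    (AdicCompletion.residueField_map_bijective S))

omit [IsLocalRing S] [IsNoetherianRing S] in
/-- **`S → Ŝ_I` is a regular homomorphism for `S` essentially of finite type over a field**:
such an `S` is excellent (`Stacks07QW_field_holds`, `IsExcellentRing.of_essFiniteType`), and the
adic completions of a quasi-excellent ring are regular homomorphisms (EGA IV₂ 7.8.3 (v),
`isRegularHom_adicCompletion_of_isQuasiExcellentRing`). [cite: EGAIV2, (7.8.3) (v)]
[cite: Temkin2008, Lemma 3.1.4] -/
theorem isRegularHom_adicCompletion_of_essFiniteType [Algebra.EssFiniteType k S] (I : Ideal S) :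
    IsRegularHom S (AdicCompletion I S) :=
  have hk : IsExcellentRing k := Stacks07QW_field_holds k k inferInstance
  isRegularHom_adicCompletion_of_isQuasiExcellentRing I
    (hk.of_essFiniteType ‹Algebra.EssFiniteType k S›).isQuasiExcellentRing

omit [Algebra k S] in
/-- The only point of `Spec Ŝ` over the closed point of `Spec S` is the closed point
(`𝔪̂ = 𝔪Ŝ`, `AdicCompletion.maximalIdeal_eq_map`). [folklore] -/
theorem specMap_eq_closedPoint_iff (q : Spec (.of (AdicCompletion (maximalIdeal S) S))) :
    specOfAlgebra S (AdicCompletion (maximalIdeal S) S) q = closedPoint S ↔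
      q = closedPoint (AdicCompletion (maximalIdeal S) S) := by
  constructor
  · intro hq
    have h1 : (maximalIdeal S).map (algebraMap S (AdicCompletion (maximalIdeal S) S)) ≤
        q.asIdeal := by
      rw [Ideal.map_le_iff_le_comap]
      have h2 := congrArg PrimeSpectrum.asIdeal hq
      rw [Spec.map_apply, PrimeSpectrum.comap_asIdeal] at h2
      exact le_of_eq h2.symm
    rw [← AdicCompletion.maximalIdeal_eq_map] at h1
    apply PrimeSpectrum.ext
    exact ((IsLocalRing.maximalIdeal.isMaximal _).eq_of_le q.2.ne_top h1).symm
  · rintro rfl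
    haveI : IsLocalHom (CommRingCat.ofHom
        (algebraMap S (AdicCompletion (maximalIdeal S) S))).hom :=
      inferInstanceAs (IsLocalHom (algebraMap S (AdicCompletion (maximalIdeal S) S)))
    exact Spec_closedPoint

end Completion

/-- **The completion of the algebraic base satisfies the atom's hypotheses** (registered sub-goal
`stub_algebraizeBlowupCompletion` of `stub_algebraizeBlowup`): for `k` perfect of characteristic
`p` and `S` regular local, essentially of finite type over `k`, with `S/𝔪` finite over `k`, the
`𝔪`-adic completion `Ŝ` has characteristic `p`, PERFECT residue field, and `S → Ŝ` is a regular
homomorphism (`S` is excellent). (Regularity, completeness and `dim Ŝ = dim S` are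
`isRegularLocalRing_adicCompletion`, Mathlib's `IsAdicComplete` instance and
`ringKrullDim_adicCompletion`.) [cite: EGAIV2, (7.8.3) (v)] [cite: Matsumura1987, §32 p. 260] -/
theorem stub_algebraizeBlowupCompletion (p : ℕ) (k : Type) [Field k] [CharP k p] [PerfectField k]
    (S : Type) [CommRing S] [IsRegularLocalRing S] [Algebra k S] [Algebra.EssFiniteType k S]
    (hfin : Module.Finite k (S ⧸ IsLocalRing.maximalIdeal S)) :
    CharP (AdicCompletion (IsLocalRing.maximalIdeal S) S) p ∧
      PerfectField (IsLocalRing.ResidueField (AdicCompletion (IsLocalRing.maximalIdeal S) S)) ∧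
      IsRegularHom S (AdicCompletion (IsLocalRing.maximalIdeal S) S) :=
  ⟨charP_adicCompletion p k S, perfectField_residueField_adicCompletion k S hfin,
    isRegularHom_adicCompletion_of_essFiniteType k S _⟩

/-! ## The base change of a birational morphism along a flat extension of domains -/

section Birational

variable {S E : Type u} [CommRing S] [CommRing E] [IsDomain S] [IsDomain E] [Algebra S E]
  [Module.Flat S E] (hinj : Function.Injective (algebraMap S E))
  {T : Scheme.{u}} (f : T ⟶ Spec (.of S)) [IrreducibleSpace T] (hbir : IsBirational f)

include hinj hbir in
/-- **Birationality survives the base change to a flat extension of domains.** If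
`f : T → Spec S` (`T` irreducible) is an isomorphism over the dense open `U`, then
`T ×_S Spec E → Spec E` is an isomorphism over the preimage `U_E` of `U`, which contains the
generic point of `Spec E`; and the preimage of `U_E` upstairs is dense: the projection
`T ×_S Spec E → T` is flat, hence generizing, so every point specialises from a point over the
generic point of `T`, which lies over `U`. [cite: StacksProject, Tag 01RN] -/
theorem isBirational_pullback_snd_specMap :
    IsBirational (pullback.snd f (specOfAlgebra S E)) := by
  set g : Spec (.of E) ⟶ Spec (.of S) := specOfAlgebra S E with hg
  set φ := pullback.fst f g with hφ
  set ψ := pullback.snd f g with hψ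
  obtain ⟨U, hU, -, hiso⟩ := hbir
  haveI := hiso
  haveI : IrreducibleSpace (Spec (.of S) : Scheme.{u}) :=
    inferInstanceAs (IrreducibleSpace (PrimeSpectrum S))
  haveI : IrreducibleSpace (Spec (.of E) : Scheme.{u}) :=
    inferInstanceAs (IrreducibleSpace (PrimeSpectrum E))
  haveI : Flat g := by
    refine (HasRingHomProperty.Spec_iff (P := @Flat)).mpr ?_
    change (algebraMap S E).Flat
    exact RingHom.flat_algebraMap_iff.mpr inferInstance
  haveI : Flat φ := MorphismProperty.pullback_fst _ _ inferInstance
  -- generic points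
  have hgη : g (genericPoint (Spec (.of E))) = genericPoint (Spec (.of S)) :=
    specMap_genericPoint_of_injective hinj
  have hfξ : f (genericPoint T) = genericPoint (Spec (.of S)) :=
    apply_genericPoint_eq_of_isIso_morphismRestrict f U hU
  have hηU : genericPoint (Spec (.of S)) ∈ (U : Set (Spec (.of S))) :=
    genericPoint_mem_of_isOpen U.2 hU.nonempty
  have hηU' : genericPoint (Spec (.of E)) ∈ ((g ⁻¹ᵁ U : (Spec (.of E)).Opens) : Set _) := by
    change g (genericPoint (Spec (.of E))) ∈ (U : Set (Spec (.of S)))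
    rw [hgη]
    exact hηU
  refine ⟨g ⁻¹ᵁ U, dense_of_genericPoint_mem_of_irreducibleSpace hηU', ?_,
    Literature.AlgebraicGeometry.Morphisms.isIso_morphismRestrict_pullback_snd f g U⟩
  -- every point of the base change specialises from a point of `ψ⁻¹ g⁻¹ U`
  have hgen : GeneralizingMap φ.base := Flat.generalizingMap φ
  rw [dense_iff_closure_eq]
  refine Set.eq_univ_of_forall fun z => ?_
  have hsp : genericPoint T ⤳ φ z := genericPoint_specializes (φ z)
  obtain ⟨z', hz'z, hz'⟩ := hgen hsp
  have hz'U : z' ∈ ((ψ ⁻¹ᵁ (g ⁻¹ᵁ U) : (pullback f g).Opens) : Set _) := by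
    change g (ψ z') ∈ (U : Set (Spec (.of S)))
    have h1 : g (ψ z') = f (φ z') := by
      rw [← Scheme.Hom.comp_apply, ← Scheme.Hom.comp_apply, pullback.condition]
    have h2 : φ z' = genericPoint T := hz'
    rw [h1, h2, hfξ]
    exact hηU
  exact closure_mono (Set.singleton_subset_iff.mpr hz'U) hz'z.mem_closure

end Birational

/-! ## The base change along a regular homomorphism: reducedness, regularity -/

section RegularHom

variable {S : Type u} (E : Type u) [CommRing S] [CommRing E] [IsNoetherianRing S]
  [IsNoetherianRing E] [Algebra S E] (hreg : IsRegularHom S E)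
  {T : Scheme.{u}} (f : T ⟶ Spec (.of S)) [LocallyOfFiniteType f]

include hreg in
/-- **`T ×_S Spec E` is reduced** for `T` reduced, locally of finite type over the Noetherian
`S`, and `S → E` a regular homomorphism: on an affine chart `Spec (Γ(T, W) ⊗_S E)` the map
`Γ(T, W) → Γ(T, W) ⊗_S E` is regular (Stacks 07C1), so reducedness ascends (Stacks 07QK).
[cite: StacksProject, Tag 07QK] [cite: Temkin2008, Cor. 3.1.5] -/
theorem isReduced_pullback_specMap_of_isRegularHom [IsReduced T] :
    IsReduced (pullback f (specOfAlgebra S E)) := by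
  haveI : IsNoetherianRing (CommRingCat.of S) := ‹IsNoetherianRing S›
  haveI : IsLocallyNoetherian T := LocallyOfFiniteType.isLocallyNoetherian f
  haveI : ∀ z : ↑(pullback f (specOfAlgebra S E)),
      _root_.IsReduced ((pullback f (specOfAlgebra S E)).presheaf.stalk z) := by
    intro z
    obtain ⟨W, hW, hzW, -⟩ := exists_isAffineOpen_mem_and_subset (X := T)
      (x := pullback.fst f (specOfAlgebra S E) z) (U := ⊤) trivial
    let iW : Spec Γ(T, W) ⟶ T := hW.fromSpec
    let φW : CommRingCat.of S ⟶ Γ(T, W) := Spec.preimage (iW ≫ f)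
    letI : Algebra S Γ(T, W) := φW.hom.toAlgebra
    have hi : iW ≫ f = Spec.map (CommRingCat.ofHom (algebraMap S Γ(T, W))) := by
      rw [RingHom.algebraMap_toAlgebra, CommRingCat.ofHom_hom, Spec.map_preimage]
    haveI : Algebra.FiniteType S Γ(T, W) := by
      have h1 : LocallyOfFiniteType (Spec.map (CommRingCat.ofHom (algebraMap S Γ(T, W)))) := by
        rw [← hi]; infer_instance
      exact RingHom.finiteType_algebraMap.mp
        ((HasRingHomProperty.Spec_iff (P := @LocallyOfFiniteType)).mp h1)
    haveI : IsNoetherianRing Γ(T, W) := IsLocallyNoetherian.component_noetherian ⟨W, hW⟩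
    haveI : Algebra.EssFiniteType S Γ(T, W) := Algebra.EssFiniteType.of_finiteType S _
    have hregW : IsRegularHom Γ(T, W) (Γ(T, W) ⊗[S] E) := hreg.baseChange_of_essFiniteType _
    haveI : _root_.IsReduced (Γ(T, W) ⊗[S] E) := hregW.isReduced
    let c := specTensorChart E f iW hi
    have hzrange : z ∈ Set.range c := by
      change z ∈ Set.range (specTensorChart E f iW hi)
      rw [range_specTensorChart, Set.mem_preimage, IsAffineOpen.range_fromSpec]
      exact hzW
    obtain ⟨ζ, rfl⟩ := hzrange
    exact isReduced_of_injective (asIso (c.stalkMap ζ)).commRingCatIsoToRingEquiv.toRingHom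
      (asIso (c.stalkMap ζ)).commRingCatIsoToRingEquiv.injective
  exact isReduced_of_isReduced_stalk _

include hreg in
/-- **Regularity ascends along `T ×_S Spec E → T`** for `S → E` regular and `T` locally of
finite type over the Noetherian `S`: if `T` is regular at the image of `z`, then `T ×_S Spec E`
is regular at `z` (Stacks 07C1 on an affine chart and Matsumura 23.7 (ii),
`IsRegularHom.isRegularLocalRing_localization_iff`). [cite: Matsumura1987, Thm. 23.7]
[cite: EGAIV2, (7.9.3)] -/
theorem isRegularLocalRing_stalk_pullback_of_isRegularHom (z : ↑(pullback f (specOfAlgebra S E)))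
    (hz : IsRegularLocalRing (T.presheaf.stalk (pullback.fst f (specOfAlgebra S E) z))) :
    IsRegularLocalRing ((pullback f (specOfAlgebra S E)).presheaf.stalk z) := by
  haveI : IsNoetherianRing (CommRingCat.of S) := ‹IsNoetherianRing S›
  haveI : IsLocallyNoetherian T := LocallyOfFiniteType.isLocallyNoetherian f
  obtain ⟨W, hW, hzW, -⟩ := exists_isAffineOpen_mem_and_subset (X := T)
    (x := pullback.fst f (specOfAlgebra S E) z) (U := ⊤) trivial
  let iW : Spec Γ(T, W) ⟶ T := hW.fromSpec
  let φW : CommRingCat.of S ⟶ Γ(T, W) := Spec.preimage (iW ≫ f)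
  letI : Algebra S Γ(T, W) := φW.hom.toAlgebra
  have hi : iW ≫ f = Spec.map (CommRingCat.ofHom (algebraMap S Γ(T, W))) := by
    rw [RingHom.algebraMap_toAlgebra, CommRingCat.ofHom_hom, Spec.map_preimage]
  haveI : Algebra.FiniteType S Γ(T, W) := by
    have h1 : LocallyOfFiniteType (Spec.map (CommRingCat.ofHom (algebraMap S Γ(T, W)))) := by
      rw [← hi]; infer_instance
    exact RingHom.finiteType_algebraMap.mp
      ((HasRingHomProperty.Spec_iff (P := @LocallyOfFiniteType)).mp h1)
  haveI : IsNoetherianRing Γ(T, W) := IsLocallyNoetherian.component_noetherian ⟨W, hW⟩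
  haveI : Algebra.EssFiniteType S Γ(T, W) := Algebra.EssFiniteType.of_finiteType S _
  haveI : IsNoetherianRing (Γ(T, W) ⊗[S] E) := isNoetherianRing_tensor_of_finiteType E Γ(T, W)
  have hregW : IsRegularHom Γ(T, W) (Γ(T, W) ⊗[S] E) := hreg.baseChange_of_essFiniteType _
  let c := specTensorChart E f iW hi
  have hzrange : z ∈ Set.range c := by
    change z ∈ Set.range (specTensorChart E f iW hi)
    rw [range_specTensorChart, Set.mem_preimage, IsAffineOpen.range_fromSpec]
    exact hzW
  obtain ⟨ζ, rfl⟩ := hzrange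
  -- `B_{ζ ∩ B}` is the local ring of `T` at the image of `z`
  have hreg₀ : IsRegularLocalRing (Localization.AtPrime
      (ζ.asIdeal.comap (algebraMap Γ(T, W) (Γ(T, W) ⊗[S] E)))) := by
    let η : PrimeSpectrum Γ(T, W) :=
      PrimeSpectrum.comap (algebraMap Γ(T, W) (Γ(T, W) ⊗[S] E)) ζ
    have hφz : pullback.fst f (specOfAlgebra S E) (c ζ) = iW η := by
      rw [← Scheme.Hom.comp_apply]
      change (specTensorChart E f iW hi ≫ pullback.fst f (specOfAlgebra S E)) ζ = _
      rw [specTensorChart_fst, Scheme.Hom.comp_apply, Spec.map_apply]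
      rfl
    have hη : IsRegularLocalRing ((Spec Γ(T, W)).presheaf.stalk η) := by
      refine (isRegularLocalRing_stalk_iff_of_isOpenImmersion iW η).mp ?_
      rw [← hφz]
      exact hz
    exact (isRegularLocalRing_stalk_Spec_iff Γ(T, W) η).mp hη
  have hregζ : IsRegularLocalRing (Localization.AtPrime ζ.asIdeal) :=
    (hregW.isRegularLocalRing_localization_iff ζ.asIdeal).mpr hreg₀
  exact (isRegularLocalRing_stalk_iff_of_isOpenImmersion c ζ).mpr
    ((isRegularLocalRing_stalk_Spec_iff _ ζ).mpr hregζ)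

end RegularHom

/-! ## Ideal sheaves on `T ×_S Spec E` above a power of `I` come from `T` (`E ≡ S mod Iᴺ`) -/

section Centre

open Scheme.IdealSheafData

/-- **Descent of centres cosupported over `V(I)`.** Let `E` be an `S`-algebra such that every
element of `B ⊗_S E` is `≡ b ⊗ 1` modulo `Iᴺ` for every `S`-algebra `B` (e.g. the `I`-adic
completion `Ŝ_I`, `exists_sub_tmul_one_mem_map_pow`), `f : T → Spec S`, `φ : T ×_S Spec E → T`
the projection and `G = I 𝒪_T` the ideal sheaf of `f⁻¹ V(I)`. Every ideal sheaf `J ⊇ (φ⁻¹G)ᴺ`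
of `T ×_S Spec E` is extended from `T`: `J = (φ_* J ∩ 𝒪_T) · 𝒪_{T ×_S E}`. On the affine
pieces `Γ(T ×_S E, φ⁻¹W) ≅ Γ(T, W) ⊗_S E ≡ Γ(T, W) (mod Iᴺ)`, so ideals containing `Iᴺ` are
extended (`Ideal.map_comap_eq_of_forall_sub_mem`) — Temkin's "`𝔍` is the completion of a
`T`-supported ideal" (proof of Thm. 3.4.1), for the scheme `T ×_S Spec Ŝ` in place of the
formal completion. [cite: Temkin2008, Thm. 3.4.1 (proof, p. 18) and Lemma 2.1.8] -/
theorem comap_map_fst_eq_of_pow_le {S : Type u} [CommRing S] (E : Type u) [CommRing E]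
    [Algebra S E] (I : Ideal S) (N : ℕ)
    (hE : ∀ (B : Type u) [CommRing B] [Algebra S B] (w : B ⊗[S] E),
      ∃ b : B, w - b ⊗ₜ 1 ∈ (I ^ N).map (algebraMap S (B ⊗[S] E)))
    {T : Scheme.{u}} (f : T ⟶ Spec (.of S)) (J : (pullback f (specOfAlgebra S E)).IdealSheafData)
    (hN : (((ofIdealTop (I.map (Scheme.ΓSpecIso (.of S)).inv.hom)).comap f).comap
      (pullback.fst f (specOfAlgebra S E))) ^ N ≤ J) :
    (J.map (pullback.fst f (specOfAlgebra S E))).comap (pullback.fst f (specOfAlgebra S E)) =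
      J := by
  set G : T.IdealSheafData := (ofIdealTop (I.map (Scheme.ΓSpecIso (.of S)).inv.hom)).comap f
    with hG
  haveI : IsAffineHom (specOfAlgebra S E) := inferInstance
  haveI : IsAffineHom (pullback.fst f (specOfAlgebra S E)) :=
    MorphismProperty.pullback_fst _ _ inferInstance
  -- the affine opens `φ⁻¹(W)`, `W ⊆ T` affine, cover the base change
  let V : T.affineOpens → (pullback f (specOfAlgebra S E)).affineOpens := fun W =>
    ⟨pullback.fst f (specOfAlgebra S E) ⁻¹ᵁ (W : T.Opens), W.2.preimage _⟩
  have hV : ⨆ W, (V W : (pullback f (specOfAlgebra S E)).Opens) = ⊤ := by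
    change ⨆ W : T.affineOpens, pullback.fst f (specOfAlgebra S E) ⁻¹ᵁ (W : T.Opens) = ⊤
    rw [← Scheme.Hom.preimage_iSup, iSup_affineOpens_eq_top]
    rfl
  refine ext_of_iSup_eq_top V hV fun W => ?_
  have hW : IsAffineOpen (W : T.Opens) := W.2
  -- `Γ(T, W)` as an `S`-algebra through `f`, and the chart identification
  letI alg : Algebra S Γ(T, W) :=
    ((f.appLE ⊤ W le_top).hom.comp (Scheme.ΓSpecIso (.of S)).inv.hom).toAlgebra
  have hi : hW.fromSpec ≫ f = Spec.map (CommRingCat.ofHom (algebraMap S Γ(T, W))) := by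
    rw [fromSpec_comp_eq_specMap f hW]
    rfl
  obtain ⟨eT, heT⟩ := exists_ringEquiv_sections_pullback_fst E f hW hi
  set θ : Γ(T, W) →+* Γ(pullback f (specOfAlgebra S E), pullback.fst f (specOfAlgebra S E) ⁻¹ᵁ W) :=
    ((pullback.fst f (specOfAlgebra S E)).app W).hom with hθ
  have heT' : ∀ y : Γ(T, W), eT (θ y) = y ⊗ₜ[S] (1 : E) := heT
  set 𝔟₀ : Ideal Γ(T, W) := (I ^ N).map (algebraMap S Γ(T, W)) with h𝔟₀
  -- every section over `φ⁻¹ W` is `≡ θ b` modulo `Iᴺ`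
  have hsurjθ : ∀ w : Γ(pullback f (specOfAlgebra S E), pullback.fst f (specOfAlgebra S E) ⁻¹ᵁ W),
      ∃ b : Γ(T, W), w - θ b ∈ 𝔟₀.map θ := by
    intro w
    obtain ⟨b, hb⟩ := hE Γ(T, W) (eT w)
    refine ⟨b, ?_⟩
    have hcomp : (eT.toRingHom.comp θ).comp (algebraMap S Γ(T, W)) =
        algebraMap S (Γ(T, W) ⊗[S] E) := by
      ext s
      simp only [RingHom.comp_apply, RingEquiv.toRingHom_eq_coe, RingHom.coe_coe, heT',
        Algebra.TensorProduct.algebraMap_apply]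
    have hmap : (I ^ N).map (algebraMap S (Γ(T, W) ⊗[S] E)) = (𝔟₀.map θ).map eT.toRingHom := by
      rw [h𝔟₀, Ideal.map_map, Ideal.map_map, hcomp]
    have hmem : eT (w - θ b) ∈ (𝔟₀.map θ).map eT.toRingHom := by
      rw [map_sub, heT', ← hmap]
      exact hb
    rw [RingEquiv.toRingHom_eq_coe, Ideal.map_comap_of_equiv, Ideal.mem_comap] at hmem
    simpa using hmem
  -- `G(W) = I Γ(T, W)`, so `𝔟₀ Γ(φ⁻¹W) = (φ⁻¹G)ᴺ (φ⁻¹ W) ⊆ J (φ⁻¹ W)`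
  have hGW : G.ideal W = I.map (algebraMap S Γ(T, W)) := by
    rw [hG, ideal_comap_of_le f _ ⟨⊤, isAffineOpen_top _⟩ W le_top, ideal_ofIdealTop_top,
      Ideal.map_map]
    rfl
  have hle𝔟 : 𝔟₀.map θ ≤ J.ideal (V W) := by
    have h1 : 𝔟₀ = (G ^ N).ideal W := by
      rw [ideal_pow, Pi.pow_apply, hGW, h𝔟₀, Ideal.map_pow]
    have h2 : ((G ^ N).ideal W).map θ =
        ((G.comap (pullback.fst f (specOfAlgebra S E))) ^ N).ideal (V W) := by
      rw [hθ, ← Scheme.Hom.appLE_eq_app,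
        ← ideal_comap_of_le (pullback.fst f (specOfAlgebra S E)) (G ^ N) W (V W) le_rfl, comap_pow]
    calc 𝔟₀.map θ = ((G ^ N).ideal W).map θ := by rw [h1]
      _ = ((G.comap (pullback.fst f (specOfAlgebra S E))) ^ N).ideal (V W) := h2
      _ ≤ J.ideal (V W) := hN (V W)
  -- conclusion on the chart
  have hL : ((J.map (pullback.fst f (specOfAlgebra S E))).comap
      (pullback.fst f (specOfAlgebra S E))).ideal (V W) = ((J.ideal (V W)).comap θ).map θ := by
    rw [ideal_comap_of_le (pullback.fst f (specOfAlgebra S E)) (J.map _) W (V W) le_rfl,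
      Scheme.Hom.appLE_eq_app, ideal_map_of_isAffineHom]
  rw [hL]
  exact Ideal.map_comap_eq_of_forall_sub_mem θ 𝔟₀ hsurjθ hle𝔟

end Centre

end Summit.ResolutionOfSingularities.ResolutionOfSingularities.Theorems

end
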